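import Summits.QuantumFields.BalabanUV.Beta.D1BFx.TorusScalarCoarseArrays

/-!
# `BalabanUV.Beta.D1BFx.TorusScalarCoarseBubble` — road «BF-x», binder row D1, slot (K), X₃(ii) ROUTE T, brick **K-TB3c PART 2, FILE 5** «THE OUTER UNFOLD
# AND THE TWO-ARRAY WORD OF `Sₛₜ`»: (i) the coarse-torus matrix pulled back through the block labels IS the fine-torus matrix of the LIFTED coarse
# kernel — **`Qindᵀ · (periodise₂ p M)^ · Qind = (periodise₂ s (liftK m M))^`** (`× Unit`: `QindUᵀ·M^·QindU = (liftKU m M)^`), the lift of a decaying ∕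
# periodic coarse kernel decays ∕ is periodic on the fine lattice; (ii) the two-array word of the mixed S-jet of FILE 3's END,
# `Â·(arr Vₛ)^·B̂·(arr Vₜ)^·Ĉ = (arr ((A∘Vₛ)∘B))^ · (arr (Vₜ∘C))^`, whose COARSE trace against `(CsqK)^` is, by cyclicity and (i), a FINE-torus trace
# of two periodised arrays against the lifted coarse leg — TA3b's bubble shape: at the road's legs,
# **`tr ((CsqK)^·QindU·(Ĝ′Ĝ′(arr Vₛ)^Ĝ′Ĝ′(arr Vₜ)^Ĝ′Ĝ′)·QindUᵀ) = tr ((arr (L∘((GG∘Vₛ)∘GG)))^ · (arr (Vₜ∘GG))^)`**, `L := liftKU m (CsqK (m+1) a)`.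

HONEST DEPENDENCY (cell records, verbatim): «continuum YM on T⁴ ⇐ BetaPertH ∧ nine spine estimates (0/9 proved); BetaPertH ⇐ (D1) ∧ (D4) ∧
CAP+tail; G-an2-4 gates asym, D1 and NE2/3/4.»  HONEST FRAMING (cell contract, verbatim): «discharging `BetaPertH` makes Bałaban's UV stability
UNCONDITIONAL — a real constructive-QFT result; it is NOT the continuum limit and NOT the Clay problem.»  THIS MODULE DISCHARGES NOTHING of (K),
of D1 or of the wall: [folklore] two-scale lattice bookkeeping over an4's `EntrywiseVolumeLimit` (`periodise₂_eq_tsum_of_rep`, `Decay₂.rowBound`,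
`summable_of_sum_le`), an2's `ExpKernelCalculus`, TA2 `PeriodicArrays` (`comp_arr_arr`, `decays_arr`, `bdd_arr`, `rowBound_arr`, `isPeriodic₂_arr`), TA3b
`TorusTraceTadpole` (`toF_comp`, `periodiseF_toF_mul_arr`, `summable_mul_of_decays_bdd`), `FibredPeriodisation.periodiseF_compF_matrix`, PART 1
`TorusGhostGram` (`CsqK`, `CsqK_imageShift`, `decays_CsqK`), FILES 1–2 (`Qind`, `tq`, `QindU`, `eU`) and FILE 4 (`sandwich_arr`, `biLoc_sandwich`,
`periodiseF_toF_arr_mul`, `GG`, `periodiseF_Ggh_mul_Ggh`, the block `ℓ¹` lemma) — all USED BY NAME.  Two data definitions [our object] (`liftK`, `liftKU`);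
no `def … : Prop`, nothing cited, 0 sorry.  NOT D1, NOT BetaPertH, NOT continuum, NOT Clay.

ABSOLUTE RULE (cell charter, verbatim): «No internally-minted statement may enter as a cited fact. Every hypothesis is either kernel-proved in this
package or a verbatim quotation of a PUBLISHED theorem with page reference. The manuscript(s) under audit are NOT citable for their own disputed
steps — they are the thing under adjudication; programme-internal (2001/route/tribunal) claims are never citable.»

WHERE THIS SITS (`HOME/b2b-balaban-beta-d1-p2/K-ASSEMBLY-SPEC-v2.md` v2.3 §2 row K-TB3c «NOT HERE» item, §4 TB5; OWNER NOTE ρ-g6-13b: TB5-2c(i) = the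
`p → ∞` limits of FILE 3's `2·hessT Ĝ′ (…) + hessT ((m+1)⁻⁴•Ĉsq) Sₛ Sₜ Sₛₜ`).  `hessT L̂c Sₛ Sₜ Sₛₜ = ½(tr(L̂c·Sₛₜ) − tr(L̂c·Sₛ·L̂c·Sₜ))`: the bubble term
and the one-array words of `Sₛₜ` are coarse arrays (FILE 4, `TorusGhostGram`'s coarse sockets); the TWO-ARRAY words of `Sₛₜ`
(`Qind·Ĝ′Ĝ′·Xₛ′·Ĝ′Ĝ′·Xₜ′·Ĝ′Ĝ′·Qindᵀ`, `Xᵢ′ = (arr s Vᵢ)^`) carry an `s`-dependent inner array and are NOT coarse tadpoles — THIS FILE rewrites their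
coarse trace as a FINE-torus bubble of two `s`-uniformly bi-localised arrays against the lifted leg, the shape TA3b unfolds.
CONTENT (d = 4, `hs : s = (m+1)·p`, scalar road kernels `MKer 4 Unit`; all [folklore]∕[our object]):
* §1 [our object] `liftK m M`; `isPeriodic₂_liftK`, `summable_abs_liftK_row` ∕ `rowBound_liftK` (`(m+1)⁴·` the coarse bound), **THE OUTER UNFOLD
  `Qind_transpose_mul_periodise₂_mul_Qind`**.  §1b [our object] `liftKU m M`; `Kfib_toF_liftKU`, **`QindU_transpose_mul_periodiseF_mul_QindU`**.
* §2 `abs_sub_le_side_mul_abs_blk_sub` (`|x i − P i| ≤ (m+1)|blk x i − blk P i| + m`), `l1_sub_le_lift`, **`decays_liftKU`** (rate `δ/(m+1)`, constant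
  `C·e^{4δm/(m+1)}`), `liftKU_imageShift`.
* §3 **`periodiseF_toF_arr_mul_arr`** (`(arr X)^·(arr Y)^ = (arr (X ∘ arr Y))^`), **`two_array_word`**, `trace_coarse_eq_fine` (cyclicity).
* §4 **`coarse_trace_two_array_word`** (the display above; legs `GG = Ggh∘Ggh`, coarse leg `CsqK (m+1) a`, any bi-localised `Vₛ`, `Vₜ` at a common rate).
NOT HERE: the limit itself (TA3b's `trace_bubble_unfold`∕`tendsto_trace_bubble` on the right-hand side — TB5-2c's call), the scalar factor
`(m+1)⁻⁴` of `Ŝ₀⁻¹` (a `trace_smul`), the dictionary.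
Provenance: NE9 formalisation swarm leaf seat `b2b-balaban-t4-ne9-formalise-leaf-02` gen 26 (cross-row prover duty NE9 → β∕D1 road «BF-x»; journal CLAIM
«K-TB3c PART 2» l.22923), 2026-08-21.
-/

noncomputable section

namespace Summit.QuantumFields.BalabanUV.Beta.D1BFx.TorusScalarCoarseBubble

open Finset Matrix
open scoped BigOperators
open Literature.MathematicalPhysics.QuantumFieldTheory.Balaban1983to89
open Literature.MathematicalPhysics.QuantumFieldTheory.Balaban1983to89.Beta
open Literature.MathematicalPhysics.QuantumFieldTheory.Balaban1983to89.B12Sec2to5 (l1 l1_nonneg)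
open B6QGQLower276 (X side blk B mem_B sum_B_const side_facts)
open ExpKernelCalculus (MKer Decays BiLoc comp)
open KernelWard (Bdd bdd_of_decays)
open Summit.QuantumFields.BalabanUV.Beta.TameKernelCalculus (decays_of_le biLoc_of_le)
open BalabanStepJetsSucc (biLoc_comp_right)
open Summit.QuantumFields.BalabanUV.Beta.D1BFx.FibredPeriodisation (periodiseF Kfib Kfib_apply periodiseF_apply periodiseF_compF_matrix)
open Summit.QuantumFields.BalabanUV.Beta.D1BFx.PeriodicArrays
open Summit.QuantumFields.BalabanUV.Beta.D1BFx.TorusTraceTadpole (toF_comp periodiseF_toF_mul_arr summable_mul_of_decays_bdd)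
open Summit.QuantumFields.BalabanUV.Beta.D1BFx.GhostLeg (blk_translate)
open Summit.QuantumFields.BalabanUV.Beta.D1BFx.PeriodisedKernels (valRep tblk blk_valRep_imageShift imageShift_eq_add_side_smul siteOf_valRep)
open Summit.QuantumFields.BalabanUV.Beta.D1BFx.TorusScalarAveraging (tq Qind Qind_apply blockSum imageShift_eq_add_zsmul)
open Summit.QuantumFields.BalabanUV.Beta.D1BFx.TorusScalarCoarseGram (eU QindU)
open Summit.QuantumFields.BalabanUV.Beta.D1BFx.TorusScalarCoarseArrays (side_mul_abs_blk_sub_le periodiseF_toF_eq_submatrix periodiseF_toF_arr_mul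
  sandwich_arr biLoc_sandwich GG decays_GG rate_GG_pos GG_imageShift periodiseF_Ggh_mul_Ggh)
open Summit.QuantumFields.BalabanUV.Beta.D1BFx.GhostLeg (Ggh)
open Summit.QuantumFields.BalabanUV.Beta.D1BFx.TorusGhostGram (CsqK CsqK_imageShift decays_CsqK)
open B6QGGQ278Zd (deltaC deltaC_pos)
open B6QGQDecay237 (deltaU deltaU_pos)

/-! ## §1 THE OUTER UNFOLD: `Qindᵀ · M̂ · Qind` is the fine-torus matrix of the LIFTED coarse kernel -/

/-- [our object] **THE LIFT OF A COARSE KERNEL TO THE FINE LATTICE** through the block labels: `liftK m M x x′ := M (blk m x) (blk m x′)`. -/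
def liftK (m : ℕ) (M : Kernel₂ 4) : Kernel₂ 4 := fun x x' => M (blk m x) (blk m x')

section Outer

variable {m s p : ℕ}

/-- [folklore] The lift of a jointly `p`-periodic coarse kernel is jointly `s`-periodic, `s = (m+1)·p`. -/
theorem isPeriodic₂_liftK (hs : s = (m + 1) * p) {M : Kernel₂ 4} (hM : IsPeriodic₂ p M) : IsPeriodic₂ s (liftK m M) := by
  intro x x' n
  simp only [liftK]
  rw [imageShift_eq_add_side_smul m hs, imageShift_eq_add_side_smul m hs, blk_translate, blk_translate, ← imageShift_eq_add_zsmul,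
    ← imageShift_eq_add_zsmul]
  exact hM _ _ n

/-- [folklore] The rows of the lift are absolutely summable when the coarse rows are (`(m+1)⁴` fine points over each coarse one), with the bound
`(m+1)⁴ · Σ′ |M (blk x) ·|`. -/
theorem summable_abs_liftK_row {M : Kernel₂ 4} {Bc : ℝ} (hMB : RowBound M Bc) (x : X 4) :
    Summable (fun x' => |liftK m M x x'|) ∧ ∑' x', |liftK m M x x'| ≤ ((m : ℝ) + 1) ^ 4 * Bc := by
  have hrow := (hMB (blk m x)).1
  have hle : ∀ S : Finset (X 4), ∑ x' ∈ S, |liftK m M x x'| ≤ ((m : ℝ) + 1) ^ 4 * Bc := by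
    intro S
    classical
    rw [← Finset.sum_fiberwise_of_maps_to (fun x' (hx' : x' ∈ S) => Finset.mem_image_of_mem (blk m) hx')]
    calc ∑ y' ∈ S.image (blk m), ∑ x' ∈ S.filter (fun x' => blk m x' = y'), |liftK m M x x'|
        = ∑ y' ∈ S.image (blk m), ((S.filter (fun x' => blk m x' = y')).card : ℝ) * |M (blk m x) y'| := by
          refine Finset.sum_congr rfl fun y' _ => ?_
          rw [Finset.sum_congr rfl fun x' hx' => by rw [liftK, (Finset.mem_filter.1 hx').2], Finset.sum_const, nsmul_eq_mul]
      _ ≤ ∑ y' ∈ S.image (blk m), ((m : ℝ) + 1) ^ 4 * |M (blk m x) y'| := by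
          refine Finset.sum_le_sum fun y' _ => mul_le_mul_of_nonneg_right ?_ (abs_nonneg _)
          have hsub : S.filter (fun x' => blk m x' = y') ⊆ B m y' := fun x' hx' => mem_B.2 (Finset.mem_filter.1 hx').2
          have h1 : ((S.filter (fun x' => blk m x' = y')).card : ℝ) ≤ (B m y').card := by exact_mod_cast Finset.card_le_card hsub
          have h2 : ((B m y').card : ℝ) = ((m : ℝ) + 1) ^ 4 := by
            have := sum_B_const (n := m) y' (1 : ℝ); rw [Finset.sum_const, nsmul_eq_mul, mul_one, mul_one] at this; exact this
          linarith
      _ = ((m : ℝ) + 1) ^ 4 * ∑ y' ∈ S.image (blk m), |M (blk m x) y'| := by rw [Finset.mul_sum]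
      _ ≤ ((m : ℝ) + 1) ^ 4 * Bc := by
          refine mul_le_mul_of_nonneg_left ((hrow.sum_le_tsum _ (fun y' _ => abs_nonneg _)).trans (hMB (blk m x)).2) (by positivity)
  have hsum : Summable fun x' => |liftK m M x x'| := summable_of_sum_le (fun _ => abs_nonneg _) hle
  exact ⟨hsum, hsum.tsum_le_of_sum_le hle⟩

/-- [folklore] A row bound for the lift. -/
theorem rowBound_liftK {M : Kernel₂ 4} {Bc : ℝ} (hMB : RowBound M Bc) : RowBound (liftK m M) (((m : ℝ) + 1) ^ 4 * Bc) :=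
  fun x => summable_abs_liftK_row hMB x

variable [NeZero s] [NeZero p]

/-- [folklore] **THE OUTER UNFOLD**: for a jointly `p`-periodic coarse kernel `M` with a row bound (`s = (m+1)·p`),
`Qindᵀ · (periodise₂ p M)^ · Qind = (periodise₂ s (liftK m M))^` — the coarse-torus matrix pulled back to the fine torus through the block labels IS the
fine-torus matrix of the lifted kernel. -/
theorem Qind_transpose_mul_periodise₂_mul_Qind (hs : s = (m + 1) * p) {M : Kernel₂ 4} {Bc : ℝ} (hM : IsPeriodic₂ p M) (hMB : RowBound M Bc) :
    (Qind m s p)ᵀ * Matrix.of (periodise₂ p M) * Qind m s p = Matrix.of (periodise₂ s (liftK m M)) := by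
  ext z z'
  rw [Matrix.mul_apply, Matrix.of_apply]
  -- the double sum collapses to `M̂ (tq z) (tq z′)`
  have hL : ∀ yb' : Site 4 p, ((Qind m s p)ᵀ * Matrix.of (periodise₂ p M)) z yb' = periodise₂ p M (tq m p z) yb' := by
    intro yb'
    rw [Matrix.mul_apply]
    simp only [Matrix.transpose_apply, Qind_apply, Matrix.of_apply]
    rw [Finset.sum_eq_single (tq m p z)]
    · rw [if_pos rfl, one_mul]
    · intro yb _ hne; rw [if_neg (Ne.symm hne), zero_mul]
    · intro h; exact absurd (Finset.mem_univ _) h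
  simp only [hL, Qind_apply]
  rw [Finset.sum_eq_single (tq m p z')]
  · rw [if_pos rfl, mul_one]
    -- representatives: `tblk` for the coarse classes, `valRep` for the fine ones
    rw [periodise₂_eq_tsum_of_rep (x := tq m p z) (y := tq m p z') (r := tblk m z) (q := tblk m z') hM hMB.summable rfl rfl,
      periodise₂_eq_tsum_of_rep (isPeriodic₂_liftK hs hM) (fun x => (rowBound_liftK hMB).summable x) (siteOf_valRep z) (siteOf_valRep z')]
    refine tsum_congr fun n => ?_
    simp only [liftK]
    rw [blk_valRep_imageShift m hs, imageShift_eq_add_zsmul]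
    rfl
  · intro yb _ hne; rw [if_neg (Ne.symm hne), mul_zero]
  · intro h; exact absurd (Finset.mem_univ _) h

end Outer

/-! ## §1b The same in the `× Unit` currency -/

/-- [our object] The lift of a scalar coarse ROAD kernel: `liftKU m M x x′ () () := M (blk m x) (blk m x′) () ()`. -/
def liftKU (m : ℕ) (M : MKer 4 Unit) : MKer 4 Unit := fun x x' _ _ => M (blk m x) (blk m x') () ()

section OuterU

variable {m s p : ℕ} [NeZero s] [NeZero p]

omit [NeZero s] [NeZero p] in
/-- [our object] Unfolding `liftKU`. -/
@[simp] theorem liftKU_apply (M : MKer 4 Unit) (x x' : X 4) (u v : Unit) : liftKU m M x x' u v = M (blk m x) (blk m x') () () := by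
  obtain ⟨⟩ := u; obtain ⟨⟩ := v; rfl

omit [NeZero s] [NeZero p] in
/-- [folklore] The scalar fibre of `liftKU` is `liftK` of the scalar fibre. -/
theorem Kfib_toF_liftKU (M : MKer 4 Unit) : Kfib (toF (liftKU m M)) () () = liftK m (Kfib (toF M) () ()) := rfl

/-- [folklore] **THE OUTER UNFOLD, `× Unit` FORM**: `QindUᵀ · M^ · QindU = (liftKU m M)^` for a jointly `p`-periodic decaying coarse road kernel `M`
(`s = (m+1)·p`; e.g. `M := CsqK (m+1) a`, PART 1's `CsqK_imageShift` ∕ `decays_CsqK`). -/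
theorem QindU_transpose_mul_periodiseF_mul_QindU (hs : s = (m + 1) * p) (M : MKer 4 Unit) {CM δM : ℝ}
    (hper : ∀ y y' t : X 4, M (imageShift p y t) (imageShift p y' t) () () = M y y' () ()) (hM : Decays M CM δM) (hδM : 0 < δM) :
    (QindU (m + 1) s p)ᵀ * Matrix.of (periodiseF p (toF M)) * QindU (m + 1) s p = Matrix.of (periodiseF s (toF (liftKU m M))) := by
  have hrb : RowBound (Kfib (toF M) () ()) (CM * ∑' w : X 4, Real.exp (-δM * l1 w)) := by
    have h2 : Decay₂ (Kfib (toF M) () ()) CM δM := fun x y => by rw [Kfib_toF]; exact hM x y () ()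
    exact h2.rowBound hδM
  have h := Qind_transpose_mul_periodise₂_mul_Qind (m := m) hs (M := Kfib (toF M) () ()) (fun y y' t => hper y y' t) hrb
  rw [periodiseF_toF_eq_submatrix, periodiseF_toF_eq_submatrix, QindU, Matrix.transpose_submatrix, Matrix.submatrix_mul_equiv,
    Matrix.submatrix_mul_equiv, show m + 1 - 1 = m from rfl, h]
  rfl

end OuterU

/-! ## §2 The lift of a decaying coarse kernel decays on the fine lattice; the lift of a periodic kernel is periodic -/

section Lift

variable {m s p : ℕ}

/-- [folklore] **FINE DISTANCE ≤ (m+1)·BLOCK DISTANCE + m** per coordinate: `|x i − P i| ≤ (m+1)·|blk x i − blk P i| + m`. -/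
theorem abs_sub_le_side_mul_abs_blk_sub (m : ℕ) (x P : X 4) (i : Fin 4) : |x i - P i| ≤ ((m : ℤ) + 1) * |blk m x i - blk m P i| + m := by
  have hs : (0 : ℤ) < (m : ℤ) + 1 := by positivity
  have hx := Int.emod_add_mul_ediv (x i) ((m : ℤ) + 1)
  have hP := Int.emod_add_mul_ediv (P i) ((m : ℤ) + 1)
  have hr0 := Int.emod_nonneg (x i) hs.ne'
  have hr1 := Int.emod_lt_of_pos (x i) hs
  have hq0 := Int.emod_nonneg (P i) hs.ne'
  have hq1 := Int.emod_lt_of_pos (P i) hs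
  rw [show blk m x i = x i / ((m : ℤ) + 1) from rfl, show blk m P i = P i / ((m : ℤ) + 1) from rfl,
    show ((m : ℤ) + 1) * |x i / ((m : ℤ) + 1) - P i / ((m : ℤ) + 1)| = |((m : ℤ) + 1) * (x i / ((m : ℤ) + 1)) - ((m : ℤ) + 1) * (P i / ((m : ℤ) + 1))|
      by rw [← mul_sub, abs_mul, abs_of_pos hs],
    show x i - P i = (((m : ℤ) + 1) * (x i / ((m : ℤ) + 1)) - ((m : ℤ) + 1) * (P i / ((m : ℤ) + 1))) + (x i % ((m : ℤ) + 1) - P i % ((m : ℤ) + 1))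
      by linarith]
  refine (abs_add_le _ _).trans ?_
  have h : |x i % ((m : ℤ) + 1) - P i % ((m : ℤ) + 1)| ≤ m := abs_le.2 ⟨by linarith, by linarith⟩
  linarith

/-- [folklore] **`ℓ¹` FORM**: `|x − P|₁ ≤ (m+1)·|blk x − blk P|₁ + 4m`. -/
theorem l1_sub_le_lift (m : ℕ) (x P : X 4) : l1 (x - P) ≤ ((m : ℝ) + 1) * l1 (blk m x - blk m P) + 4 * m := by
  have hc : ∀ i : Fin 4, |(((x - P) i : ℤ) : ℝ)| ≤ ((m : ℝ) + 1) * |(((blk m x - blk m P) i : ℤ) : ℝ)| + m := by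
    intro i
    have h3 : ((|x i - P i| : ℤ) : ℝ) ≤ ((((m : ℤ) + 1) * |blk m x i - blk m P i| + m : ℤ) : ℝ) := by
      exact_mod_cast abs_sub_le_side_mul_abs_blk_sub m x P i
    simp only [Int.cast_abs, Int.cast_add, Int.cast_mul, Int.cast_natCast, Int.cast_one, Pi.sub_apply, Int.cast_sub] at h3 ⊢
    exact h3
  simp only [l1]
  calc ∑ μ, |(((x - P) μ : ℤ) : ℝ)| ≤ ∑ μ : Fin 4, (((m : ℝ) + 1) * |(((blk m x - blk m P) μ : ℤ) : ℝ)| + m) := Finset.sum_le_sum fun i _ => hc i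
    _ = ((m : ℝ) + 1) * ∑ μ, |(((blk m x - blk m P) μ : ℤ) : ℝ)| + 4 * m := by
        rw [Finset.sum_add_distrib, Finset.sum_const, Finset.card_univ, Fintype.card_fin, nsmul_eq_mul, ← Finset.mul_sum]; push_cast; ring

/-- [folklore] **THE LIFT OF A DECAYING COARSE KERNEL DECAYS ON THE FINE LATTICE** (rate `δ/(m+1)`, constant `C·e^{4δm/(m+1)}`). -/
theorem decays_liftKU {M : MKer 4 Unit} {C δ : ℝ} (hM : Decays M C δ) (hδ : 0 ≤ δ) :
    Decays (liftKU m M) (C * Real.exp (δ / ((m : ℝ) + 1) * (4 * m))) (δ / ((m : ℝ) + 1)) := by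
  intro x x' u v
  have hC : 0 ≤ C := hM.nonneg ()
  have hm : (0 : ℝ) < (m : ℝ) + 1 := by positivity
  rw [liftKU_apply]
  refine (hM _ _ () ()).trans ?_
  rw [mul_assoc, ← Real.exp_add]
  refine mul_le_mul_of_nonneg_left (Real.exp_le_exp.2 ?_) hC
  have h := l1_sub_le_lift m x x'
  have hδ' : 0 ≤ δ / ((m : ℝ) + 1) := div_nonneg hδ hm.le
  -- `−δ·|blk x − blk x′|₁ ≤ (δ/(m+1))·(4m) − (δ/(m+1))·|x − x′|₁`
  have h2 : δ / ((m : ℝ) + 1) * l1 (x - x') ≤ δ / ((m : ℝ) + 1) * (((m : ℝ) + 1) * l1 (blk m x - blk m x') + 4 * m) :=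
    mul_le_mul_of_nonneg_left h hδ'
  have h3 : δ / ((m : ℝ) + 1) * (((m : ℝ) + 1) * l1 (blk m x - blk m x')) = δ * l1 (blk m x - blk m x') := by
    field_simp
  nlinarith

/-- [folklore] The lift of a jointly `p`-periodic coarse road kernel is jointly `s`-periodic (`s = (m+1)·p`). -/
theorem liftKU_imageShift (hs : s = (m + 1) * p) {M : MKer 4 Unit} (hper : ∀ y y' t : X 4, M (imageShift p y t) (imageShift p y' t) () () = M y y' () ())
    (x x' t : X 4) (u v : Unit) : liftKU m M (imageShift s x t) (imageShift s x' t) u v = liftKU m M x x' u v := by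
  rw [liftKU_apply, liftKU_apply, imageShift_eq_add_side_smul m hs, imageShift_eq_add_side_smul m hs, blk_translate, blk_translate,
    ← imageShift_eq_add_zsmul, ← imageShift_eq_add_zsmul, hper]

end Lift

/-! ## §3 Two arrays: the `Sₛₜ` word `Â·(arr Vₛ)^·B̂·(arr Vₜ)^·Ĉ` and its coarse trace as a fine-torus bubble -/

section TwoArrays

variable {s : ℕ} [NeZero s] {A Bk Ck Xk Yk Vs Vt : MKer 4 Unit} {P Q P' Q' : X 4} {CA δA CB δB CC δC C C' δ : ℝ}

/-- [folklore] **TWO ARRAYS ON THE TORUS**: `(arr s X)^ · (arr s Y)^ = (arr s (X ∘ arr s Y))^` for bi-localised `X`, `Y` at a common rate (TA2's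
`comp_arr_arr` + the fibred product rule; TA3b's `periodiseF_toF_bubble` without the legs). -/
theorem periodiseF_toF_arr_mul_arr (hX : BiLoc Xk P Q C δ) (hY : BiLoc Yk P' Q' C' δ) (hδ : 0 < δ) :
    Matrix.of (periodiseF s (toF (arr s Xk))) * Matrix.of (periodiseF s (toF (arr s Yk))) = Matrix.of (periodiseF s (toF (arr s (comp Xk (arr s Yk))))) := by
  rw [← comp_arr_arr hX hδ hY hδ,
    ← toF_comp (fun x z a b f => summable_mul_of_decays_bdd (decays_arr hX hδ s) (half_pos hδ) (bdd_arr hY hδ s) x z a b f),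
    periodiseF_compF_matrix (summable_abs_row_arr hX hδ s) (isPeriodic₂_arr s _) (rowBound_arr hY hδ s)]

/-- [folklore] **THE TWO-ARRAY WORD**: `Â·(arr Vₛ)^·B̂·(arr Vₜ)^·Ĉ = (arr ((A∘Vₛ)∘B))^ · (arr (Vₜ∘C))^` — two periodised arrays of bi-localised vertices
(`TorusScalarCoarseArrays.sandwich_arr` + `periodiseF_toF_arr_mul`), ready for `periodiseF_toF_arr_mul_arr` ∕ TA3b's bubble unfolding. -/
theorem two_array_word (hA : Decays A CA δA) (hδA : 0 < δA) (hAper : ∀ x y t : X 4, ∀ u v : Unit, A (imageShift s x t) (imageShift s y t) u v = A x y u v)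
    (hB : Decays Bk CB δB) (hδB : 0 < δB) (hBper : ∀ x y t : X 4, ∀ u v : Unit, Bk (imageShift s x t) (imageShift s y t) u v = Bk x y u v)
    (hC : Decays Ck CC δC) (hδC : 0 < δC) (hCper : ∀ x y t : X 4, ∀ u v : Unit, Ck (imageShift s x t) (imageShift s y t) u v = Ck x y u v)
    (hVs : BiLoc Vs P Q C δ) (hVt : BiLoc Vt P' Q' C' δ) (hδ : 0 < δ) :
    Matrix.of (periodiseF s (toF A)) * Matrix.of (periodiseF s (toF (arr s Vs))) * Matrix.of (periodiseF s (toF Bk))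
        * Matrix.of (periodiseF s (toF (arr s Vt))) * Matrix.of (periodiseF s (toF Ck))
      = Matrix.of (periodiseF s (toF (arr s (comp (comp A Vs) Bk)))) * Matrix.of (periodiseF s (toF (arr s (comp Vt Ck)))) := by
  rw [sandwich_arr hA hδA hAper hB hδB hBper hVs hδ, Matrix.mul_assoc, periodiseF_toF_arr_mul hC hδC hCper hVt hδ]

omit [NeZero s] in
/-- [folklore] **THE COARSE TRACE IS A FINE TRACE** (cyclicity): `tr (M̂ · (Q·F·Qᵀ)) = tr ((Qᵀ·M̂·Q) · F)` — with `Q := QindU`, `M̂ := (CsqK)^` and the OUTER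
UNFOLD this reads the coarse one-loop traces of FILE 3's S-jets as FINE-torus traces against the lifted coarse leg `(liftKU m CsqK)^`. -/
theorem trace_coarse_eq_fine {ι κ : Type*} [Fintype ι] [Fintype κ] (M : Matrix κ κ ℝ) (Q : Matrix κ ι ℝ) (F : Matrix ι ι ℝ) :
    Matrix.trace (M * (Q * F * Qᵀ)) = Matrix.trace ((Qᵀ * M * Q) * F) := by
  rw [show M * (Q * F * Qᵀ) = (M * Q * F) * Qᵀ by simp only [Matrix.mul_assoc], Matrix.trace_mul_comm, ← Matrix.mul_assoc, ← Matrix.mul_assoc]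

end TwoArrays

/-! ## §4 The road's instance: legs `Ĝ′Ĝ′`, coarse leg `(CsqK)^` — the two-array word of `Sₛₜ` as a FINE-torus bubble -/

section Ghost

variable (m : ℕ) (a : ℝ) {s p : ℕ} [NeZero s] [NeZero p]

/-- [folklore] **THE COARSE TRACE OF THE TWO-ARRAY WORD OF `Sₛₜ` IS A FINE-TORUS BUBBLE OF TWO ARRAYS**: for bi-localised fine vertices `Vₛ`, `Vₜ` at a
common rate and `s = (m+1)·p`,
`tr ((CsqK)^ · QindU·(Ĝ′Ĝ′·(arr Vₛ)^·Ĝ′Ĝ′·(arr Vₜ)^·Ĝ′Ĝ′)·QindUᵀ) = tr ((arr s (L ∘ ((GG∘Vₛ)∘GG)))^ · (arr s (Vₜ∘GG))^)`, `L := liftKU m (CsqK (m+1) a)`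
the LIFTED coarse leg (jointly `s`-periodic, decaying) — the shape of TA3b's bubble unfolding (`TorusTraceTadpole.trace_bubble_unfold` ∕
`tendsto_trace_bubble` with unit legs), both vertices bi-localised uniformly in `s`. -/
theorem coarse_trace_two_array_word (ha : 0 < a) (hs : s = (m + 1) * p) {Vs Vt : MKer 4 Unit} {P Q P' Q' : X 4} {C C' δ : ℝ}
    (hVs : BiLoc Vs P Q C δ) (hVt : BiLoc Vt P' Q' C' δ) (hδ : 0 < δ) :
    Matrix.trace (Matrix.of (periodiseF p (toF (CsqK (m + 1) a))) *
        (QindU (m + 1) s p *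
          (Matrix.of (periodiseF s (toF (Ggh (m + 1) a))) * Matrix.of (periodiseF s (toF (Ggh (m + 1) a)))
            * Matrix.of (periodiseF s (toF (arr s Vs)))
            * (Matrix.of (periodiseF s (toF (Ggh (m + 1) a))) * Matrix.of (periodiseF s (toF (Ggh (m + 1) a))))
            * Matrix.of (periodiseF s (toF (arr s Vt)))
            * (Matrix.of (periodiseF s (toF (Ggh (m + 1) a))) * Matrix.of (periodiseF s (toF (Ggh (m + 1) a)))))
          * (QindU (m + 1) s p)ᵀ))
      = Matrix.trace (Matrix.of (periodiseF s (toF (arr s (comp (liftKU m (CsqK (m + 1) a)) (comp (comp (GG m a) Vs) (GG m a))))))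
          * Matrix.of (periodiseF s (toF (arr s (comp Vt (GG m a)))))) := by
  have hG := decays_GG (m := m) ha
  have hGr := rate_GG_pos (m := m) ha
  have hGper := GG_imageShift (m := m) (a := a) ha hs
  -- the lifted coarse leg
  have hC : ∀ y y' t : X 4, CsqK (m + 1) a (imageShift p y t) (imageShift p y' t) () () = CsqK (m + 1) a y y' () () :=
    fun y y' t => CsqK_imageShift (m + 1) a ha p y y' t () ()
  have hL := decays_liftKU (m := m) (decays_CsqK (m + 1) a ha) (by have := deltaC_pos 4 ha; positivity)
  have hLr : 0 < deltaC 4 a / 4 / ((m : ℝ) + 1) := by have := deltaC_pos 4 ha; positivity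
  have hLper := liftKU_imageShift (m := m) hs hC
  -- the dressed first vertex is bi-localised
  obtain ⟨C₁, hW⟩ := biLoc_sandwich hG hGr hG hGr hVs hδ
  have hδ₁ : 0 < min (min (deltaU 4 a / (4 * ((m + 1 : ℕ) : ℝ)) / 2) (deltaU 4 a / (4 * ((m + 1 : ℕ) : ℝ)) / 2)) δ / 4 := by
    have := lt_min (lt_min hGr hGr) hδ; positivity
  rw [trace_coarse_eq_fine, QindU_transpose_mul_periodiseF_mul_QindU hs _ hC (decays_CsqK (m + 1) a ha) (by have := deltaC_pos 4 ha; positivity),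
    periodiseF_Ggh_mul_Ggh ha hs, two_array_word hG hGr hGper hG hGr hGper hG hGr hGper hVs hVt hδ, ← Matrix.mul_assoc,
    periodiseF_toF_mul_arr hL hLr hLper hW hδ₁]

end Ghost

end Summit.QuantumFields.BalabanUV.Beta.D1BFx.TorusScalarCoarseBubble

end
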